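import Summits.Ventures.YMGap.RobustBall.RobustAreaLawRows
import Summits.Ventures.YMGap.RobustBall.RobustSlabDoorVertex
import Literature.MathematicalPhysics.QuantumFieldTheory.Balaban1983to89.StrongCouplingKernelWindow
import HarnessLib

/-!
# Robust ball (Y2), area-law side, part 9 — the AFFINE-VERTEX row condition and the sharper certified SU(2) rows

HONEST FRAMING: venture file of the cell `pub-ymgap` (QuantumFields programme), track ROBUST-BALL.  The ball's Lipschitz constraint is PER LINK,
`ℓ_s(e) + Λ(e) ≤ ε₁`; feeding the site-dependent door (`RobustSlabDoorVertex`) with `ℓ(x̄) = ℓ_s(e_x̄)`, `Λ₀(x̄) = Λ(e_x̄)` gives the Dobrushin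
row sum `e^{ε₀} c_W (1 + 2√N ℓ) + √N Λ₀ ≤ max over the two vertices`, i.e. the AFFINE-VERTEX ROW CONDITION
`e^{ε₀} c_W (1 + 2√N ε₁) < 1 ∧ e^{ε₀} c_W + √N ε₁ < 1`, `c_W = 2n|β/N|K` (DESIGN §6) — `areaLawOnBall_of_oneLinkKRModulus_vertex`.  Certified
`SU(2)`, `d = 4` rows (quarter modulus `K = 1`, `c_W = 3β_W/2`): `(β⋆_W, ε₀, ε₁) = (1/3, 3/10, 3/20)` and `(1/2, 3/25, 3/50)`, i.e. `ε = 0.15`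
and `0.06` in the one-parameter convention (lossy rows of part 7: `0.10`, `0.04`).  Strong-coupling finite-lattice statement; nothing about
the continuum, a mass gap, or Clay.
-/

noncomputable section

open MeasureTheory ProbabilityTheory
open Literature.Probability.LatticeModels hiding glue
open Literature.Probability.LatticeModels.DobrushinMetric
open Literature.MathematicalPhysics.QuantumLattice (fundamentalRep continuous_fundamentalRep fundamentalRep_apply)
open Literature.MathematicalPhysics.QuantumFieldTheory
open Literature.MathematicalPhysics.QuantumFieldTheory.DurhuusFrohlich
open Literature.MathematicalPhysics.QuantumFieldTheory.Balaban1983to89.StrongCouplingDobrushinWindow (OneLinkKRModulus)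

namespace Summit.Ventures.YMGap.RobustBall

variable {n L N : ℕ}

/-- **Slab covariance on the ball, affine-vertex form.**  With `c_W = 2n|βt|K`, `c = e^{ε₀}c_W + max(2√N e^{ε₀} c_W, √N)·ε₁ ≤ 1`:
the perturbed slab laws of every member of `ClusterDomainFR ε₀ ε₁ r` cluster with constants `(8N/c', (−log c')/r_W)`. [folklore] -/
theorem slabCovariance_of_oneLinkKRModulus_vertex [NeZero L] (hN : 1 ≤ N) (βt : ℝ) {R K : ℝ} (hK : 0 ≤ K)
    (hmod : OneLinkKRModulus N R K) (hR : |βt| * (2 * (n : ℝ)) ≤ R) {ε₀ ε₁ : ℝ} (r mv : ℕ)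
    (hc : Real.exp ε₀ * (2 * (n : ℝ) * |βt| * K) +
      max (2 * Real.sqrt N * (Real.exp ε₀ * (2 * (n : ℝ) * |βt| * K))) (Real.sqrt N) * ε₁ ≤ 1)
    (W : Perturbation (n + 1) L N) (hWball : W ∈ ClusterDomainFR ε₀ ε₁ r) (_hWloc : IsSlabLocal mv W)
    (v : Fin (n + 1)) (t : ZMod L) (rest : {e : Edge (n + 1) L // ¬ IsSlab v t e} → SU N) (x y : Site n L)
    (i j k l : Fin N) (φ ψ : ℂ → ℝ) (hφ : φ = Complex.re ∨ φ = Complex.im) (hψ : ψ = Complex.re ∨ ψ = Complex.im) :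
    |cov[fun Q => φ ((Q x : Matrix (Fin N) (Fin N) ℂ) i j),
        fun Q => ψ ((((Q y)⁻¹ : Matrix.specialUnitaryGroup (Fin N) ℂ) : Matrix (Fin N) (Fin N) ℂ) k l);
        slabLawW v t βt W.total rest]| ≤
      8 * N * (max (Real.exp ε₀ * (2 * (n : ℝ) * |βt| * K) +
          max (2 * Real.sqrt N * (Real.exp ε₀ * (2 * (n : ℝ) * |βt| * K))) (Real.sqrt N) * ε₁) (1 / 2))⁻¹ *
        Real.exp (-(-Real.log (max (Real.exp ε₀ * (2 * (n : ℝ) * |βt| * K) +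
          max (2 * Real.sqrt N * (Real.exp ε₀ * (2 * (n : ℝ) * |βt| * K))) (Real.sqrt N) * ε₁) (1 / 2)) /
            (max (n * r) 1 : ℕ)) * torusGraphDist x y) := by
  classical
  set cW : ℝ := 2 * (n : ℝ) * |βt| * K with hcW
  set M : ℝ := max (2 * Real.sqrt N * (Real.exp ε₀ * cW)) (Real.sqrt N) with hM
  obtain ⟨hrange, w, hosc, hlip⟩ := hWball
  have hcW0 : 0 ≤ cW := by positivity
  have hM0 : 0 ≤ M := le_max_of_le_right (Real.sqrt_nonneg _)
  have hsl0 : ∀ e, 0 ≤ w.selfLipLoad 0 e := fun e =>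
    Finset.sum_nonneg fun X _ => mul_nonneg (Real.exp_pos _).le ((w.lip_spec X).nonneg e)
  have hcl0 : ∀ e, 0 ≤ w.crossLipLoad 0 e := fun e => Finset.sum_nonneg fun y _ => crossLip_nonneg w 0 e y
  have hε₁ : 0 ≤ ε₁ := by
    have e0 : Edge (n + 1) L := (fun _ => 0, v)
    exact le_trans (add_nonneg (hsl0 e0) (hcl0 e0)) (hlip e0)
  have hc0 : 0 ≤ Real.exp ε₀ * cW + M * ε₁ := by positivity
  refine slabLawW_entry_cov_le_site (n := n) (L := L) (N := N) (W := W.total) hN v t (β := βt) (R := R) (K := K)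
    (δ := ε₀) (c := Real.exp ε₀ * cW + M * ε₁) hK (fun x' => w.selfLipLoad 0 (vlinkAt v t x'))
    (fun x' => w.crossLipLoad 0 (vlinkAt v t x')) (fun x' => hsl0 _) hR hmod W.measurable_total W.exists_abs_total_le rest
    (nbrBall r) (not_mem_nbrBall r) (fun x' η η' h => siteTiltW_total_dep W rest hrange x' η η' h)
    (fun x' ω g g' => (siteTiltW_total_osc W rest w x' ω g g').trans (hosc _))
    (fun x' ω g g' => siteTiltW_total_lip W rest w x' ω g g')
    (crossCoeff W w v t) (fun x' y' => crossCoeff_nonneg W w x' y')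
    (fun x' y' ω η h => siteTiltW_total_cross W rest w x' y' h)
    (fun x' => crossCoeff_rowsum_le W w r x') hc0 hc (fun x' => ?_) (le_max_right _ _)
    (fun z w' hw' => dist_le_of_mem_nbr r z w' hw') x y i j k l φ ψ hφ hψ
  -- the affine row at `x'` is below the vertex bound
  set ℓ := w.selfLipLoad 0 (vlinkAt v t x') with hℓ
  set Λ := w.crossLipLoad 0 (vlinkAt v t x') with hΛ
  have hsum : ℓ + Λ ≤ ε₁ := hlip _
  have h1 : 2 * Real.sqrt N * (Real.exp ε₀ * cW) * ℓ ≤ M * ℓ := mul_le_mul_of_nonneg_right (le_max_left _ _) (hsl0 _)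
  have h2 : Real.sqrt N * Λ ≤ M * Λ := mul_le_mul_of_nonneg_right (le_max_right _ _) (hcl0 _)
  calc Real.exp ε₀ * (1 + 2 * Real.sqrt N * ℓ) * cW + Real.sqrt N * Λ
      = Real.exp ε₀ * cW + 2 * Real.sqrt N * (Real.exp ε₀ * cW) * ℓ + Real.sqrt N * Λ := by ring
    _ ≤ Real.exp ε₀ * cW + M * ℓ + M * Λ := by linarith
    _ = Real.exp ε₀ * cW + M * (ℓ + Λ) := by ring
    _ ≤ Real.exp ε₀ * cW + M * ε₁ := by nlinarith

/-- **AREA LAW ON THE BALL, AFFINE-VERTEX ROW CONDITION** (DESIGN §6): `N ≥ 2`, one-link modulus on the slab ball, `c_W = 2n|β/N|K`; if both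
vertices of the per-link load constraint satisfy Dobrushin's condition — `e^{ε₀} c_W (1 + 2√N ε₁) < 1` (all Lipschitz load on the link itself)
and `e^{ε₀} c_W + √N ε₁ < 1` (all of it cross) — then `AreaLawOnBall N (n+1) β ε₀ ε₁ r mv`. [cite: CaoNissimSheffield2025dynamical, Theorem 2.3] -/
theorem areaLawOnBall_of_oneLinkKRModulus_vertex (hN : 2 ≤ N) (β : ℝ) {R K : ℝ} (hK : 0 ≤ K) (hmod : OneLinkKRModulus N R K)
    (hR : |β / N| * (2 * (n : ℝ)) ≤ R) {ε₀ ε₁ : ℝ} (r : ℕ) {mv : ℕ} (hmv : 1 ≤ mv)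
    (hv1 : Real.exp ε₀ * (2 * (n : ℝ) * |β / N| * K) * (1 + 2 * Real.sqrt N * ε₁) < 1)
    (hv2 : Real.exp ε₀ * (2 * (n : ℝ) * |β / N| * K) + Real.sqrt N * ε₁ < 1) :
    AreaLawOnBall N (n + 1) β ε₀ ε₁ r mv := by
  set cW : ℝ := 2 * (n : ℝ) * |β / N| * K with hcW
  have hc : Real.exp ε₀ * cW + max (2 * Real.sqrt N * (Real.exp ε₀ * cW)) (Real.sqrt N) * ε₁ < 1 := by
    rcases le_total (2 * Real.sqrt N * (Real.exp ε₀ * cW)) (Real.sqrt N) with h | h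
    · rw [max_eq_right h]; exact hv2
    · rw [max_eq_left h]; nlinarith
  exact areaLawOnBall_of_slabCovariance (n := n) hN β ε₀ ε₁ r hmv (doorRate_pos hc (le_max_right (n * r) 1))
    fun L _ W hWball hWloc v t rest x y i j k l φ ψ hφ hψ =>
      slabCovariance_of_oneLinkKRModulus_vertex (by omega) (β / N) hK hmod hR r mv hc.le W hWball hWloc v t rest x y
        i j k l φ ψ hφ hψ

/-- **SU(2), d = 4 vertex rows, schematic form** (`K = 1` on radius `≤ 1`, `c_W = 3β_W/2`): the two vertex conditions
`e^{ε₀}(3β_W/2)(1 + 2√2 ε₁) < 1` and `e^{ε₀}(3β_W/2) + √2 ε₁ < 1` give `AreaLawOnBall 2 4 (β_W/2) ε₀ ε₁ r mv`. [folklore] -/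
theorem su2_areaLawOnBall_of_vertexRow {βW ε₀ ε₁ : ℝ} (hβ : 0 ≤ βW) (hβ1 : 3 * βW / 2 ≤ 1)
    (r : ℕ) {mv : ℕ} (hmv : 1 ≤ mv)
    (hv1 : Real.exp ε₀ * (3 * βW / 2) * (1 + 2 * Real.sqrt 2 * ε₁) < 1)
    (hv2 : Real.exp ε₀ * (3 * βW / 2) + Real.sqrt 2 * ε₁ < 1) :
    AreaLawOnBall 2 (3 + 1) (βW / 2) ε₀ ε₁ r mv := by
  have hmod := SlabAreaLawDimensions.su2_oneLinkKRModulus_of_le_one (R := 3 * βW / 2) hβ1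
  have habs : |βW / 2 / (2 : ℕ)| = βW / 4 := by
    rw [abs_of_nonneg (by positivity)]; push_cast; ring
  have hcW : 2 * ((3 : ℕ) : ℝ) * |βW / 2 / (2 : ℕ)| * 1 = 3 * βW / 2 := by rw [habs]; push_cast; ring
  refine areaLawOnBall_of_oneLinkKRModulus_vertex (n := 3) le_rfl (βW / 2) zero_le_one hmod
    (by rw [habs]; push_cast; linarith) r hmv ?_ ?_
  · rw [hcW]; exact_mod_cast hv1
  · rw [hcW]; exact_mod_cast hv2

/-- `e^{3/10} ≤ 137/100`. [folklore] -/
theorem exp_three_tenths_le : Real.exp (3 / 10 : ℝ) ≤ 137 / 100 := by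
  have h := Real.exp_bound (x := (3 / 10 : ℝ)) (by norm_num) (n := 3) (by norm_num)
  have hsum : ∑ i ∈ Finset.range 3, (3 / 10 : ℝ) ^ i / (i.factorial : ℝ) = 269 / 200 := by
    simp [Finset.sum_range_succ, Nat.factorial]; norm_num
  rw [hsum] at h
  have h' := (abs_le.1 h).2
  have : |(3 / 10 : ℝ)| ^ 3 * ((Nat.succ 3 : ℕ) / ((Nat.factorial 3 : ℕ) * (3 : ℕ) : ℝ)) = 3 / 500 := by norm_num [Nat.factorial]
  rw [this] at h'
  linarith

/-- `e^{3/25} ≤ 1128/1000`. [folklore] -/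
theorem exp_three_25_le : Real.exp (3 / 25 : ℝ) ≤ 1128 / 1000 := by
  have h := Real.exp_bound (x := (3 / 25 : ℝ)) (by norm_num) (n := 3) (by norm_num)
  have hsum : ∑ i ∈ Finset.range 3, (3 / 25 : ℝ) ^ i / (i.factorial : ℝ) = 1409 / 1250 := by
    simp [Finset.sum_range_succ, Nat.factorial]; norm_num
  rw [hsum] at h
  have h' := (abs_le.1 h).2
  have : |(3 / 25 : ℝ)| ^ 3 * ((Nat.succ 3 : ℕ) / ((Nat.factorial 3 : ℕ) * (3 : ℕ) : ℝ)) = 6 / 15625 := by norm_num [Nat.factorial]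
  rw [this] at h'
  linarith

/-- **CERTIFIED SU(2), d = 4 AREA-LAW ROW ON THE BALL at `β⋆_W = 1/3`, affine vertex: `ε = 3/20`** — `AreaLawOnBall 2 4 (1/6) (3/10) (3/20) r mv`
for every range `r` and vertical diameter `mv ≥ 1` (one-parameter ball `ε₀ = 2ε`, `ε₁ = ε` with `ε = 0.15`; DESIGN screen 0.159).
Certificate: `e^{3/10} ≤ 1.37`, `√2 ≤ 1.415`: vertices `1.37·0.5·(1 + 2·1.415·0.15) = 0.9758 < 1` and `0.685 + 0.2123 < 1`. [folklore] -/
theorem su2_areaLawOnBall_oneThird_vertex (r : ℕ) {mv : ℕ} (hmv : 1 ≤ mv) :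
    AreaLawOnBall 2 4 (1 / 6) (3 / 10) (3 / 20) r mv := by
  have h6 : (1 / 6 : ℝ) = 1 / 3 / 2 := by norm_num
  rw [h6]
  show AreaLawOnBall 2 (3 + 1) _ _ _ r mv
  refine su2_areaLawOnBall_of_vertexRow (βW := 1 / 3) (by norm_num) (by norm_num) r hmv ?_ ?_
  · have he := exp_three_tenths_le
    have hs := sqrt_two_le_1415
    have he0 : 0 < Real.exp (3 / 10 : ℝ) := Real.exp_pos _
    have hs0 : 0 ≤ Real.sqrt 2 := Real.sqrt_nonneg _
    nlinarith [mul_nonneg he0.le hs0]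
  · have he := exp_three_tenths_le
    have hs := sqrt_two_le_1415
    nlinarith

/-- **CERTIFIED SU(2), d = 4 AREA-LAW ROW ON THE BALL at `β⋆_W = 1/2`, affine vertex: `ε = 3/50`** — `AreaLawOnBall 2 4 (1/4) (3/25) (3/50) r mv`
(DESIGN screen 0.062).  Certificate: `e^{3/25} ≤ 1.128`: vertex `1.128·0.75·(1 + 2·1.415·0.06) = 0.9897 < 1`, `0.846 + 0.085 < 1`. [folklore] -/
theorem su2_areaLawOnBall_oneHalf_vertex (r : ℕ) {mv : ℕ} (hmv : 1 ≤ mv) :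
    AreaLawOnBall 2 4 (1 / 4) (3 / 25) (3 / 50) r mv := by
  have h6 : (1 / 4 : ℝ) = 1 / 2 / 2 := by norm_num
  rw [h6]
  show AreaLawOnBall 2 (3 + 1) _ _ _ r mv
  refine su2_areaLawOnBall_of_vertexRow (βW := 1 / 2) (by norm_num) (by norm_num) r hmv ?_ ?_
  · have he := exp_three_25_le
    have hs := sqrt_two_le_1415
    have he0 : 0 < Real.exp (3 / 25 : ℝ) := Real.exp_pos _
    have hs0 : 0 ≤ Real.sqrt 2 := Real.sqrt_nonneg _
    nlinarith [mul_nonneg he0.le hs0]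
  · have he := exp_three_25_le
    have hs := sqrt_two_le_1415
    nlinarith


/-- **ALL-`N`, EVERY-`d` AREA LAW ON THE BALL from the Bakry–Émery one-link modulus** (hypothesis-free input: the tree's
`StrongCouplingKernelWindow.oneLinkKRModulus_SU`, `K = 1/(1/2 − R)` on the slab ball `R = 2n|β/N| < 1/2`, Shen–Zhu–Zhu Lemma 4.1): with the
slab Dobrushin constant `c_W = R/(1/2 − R)` the affine-vertex conditions `e^{ε₀}c_W(1 + 2√N ε₁) < 1`, `e^{ε₀}c_W + √N ε₁ < 1` give
`AreaLawOnBall N (n+1) β ε₀ ε₁ r mv` for every `N ≥ 2`, `n`, `r`, `mv ≥ 1`.  At `ε₀ = ε₁ = 0` this is the Wilson threshold `R < 1/4`, i.e.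
CNS25's `β/N < 1/(8(d−1))`. [cite: CaoNissimSheffield2025dynamical, Theorem 1.6] [cite: arXiv220412737, Lemma 4.1] -/
theorem areaLawOnBall_SU_of_bakryEmery (hN : 2 ≤ N) (β : ℝ) (hR : |β / N| * (2 * (n : ℝ)) < 1 / 2) {ε₀ ε₁ : ℝ} (r : ℕ) {mv : ℕ}
    (hmv : 1 ≤ mv)
    (hv1 : Real.exp ε₀ * (|β / N| * (2 * (n : ℝ)) / (1 / 2 - |β / N| * (2 * (n : ℝ)))) * (1 + 2 * Real.sqrt N * ε₁) < 1)
    (hv2 : Real.exp ε₀ * (|β / N| * (2 * (n : ℝ)) / (1 / 2 - |β / N| * (2 * (n : ℝ)))) + Real.sqrt N * ε₁ < 1) :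
    AreaLawOnBall N (n + 1) β ε₀ ε₁ r mv := by
  set R : ℝ := |β / N| * (2 * (n : ℝ)) with hRdef
  have hpos : 0 < 1 / 2 - R := by linarith
  have hK : 0 ≤ 1 / (1 / 2 - R) := by positivity
  have hmod := Balaban1983to89.StrongCouplingKernelWindow.oneLinkKRModulus_SU hN hR
  have hcW : 2 * (n : ℝ) * |β / N| * (1 / (1 / 2 - R)) = R / (1 / 2 - R) := by rw [hRdef]; ring
  refine areaLawOnBall_of_oneLinkKRModulus_vertex (n := n) hN β hK hmod le_rfl r hmv ?_ ?_
  · rw [hcW]; exact hv1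
  · rw [hcW]; exact hv2

end Summit.Ventures.YMGap.RobustBall
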